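import Literature.Geometry.Lorentzian.KerrCurvatureInvariants
import Literature.Geometry.Lorentzian.SpacetimeKretschmannScalar
import HarnessLib

/-!
# The Kretschmann scalar of slowly rotating Kerr is bounded below on a horizon collar

From the closed form `|Rm|²(g_{M,a}) = 48 M² Re (r + i a cos θ)⁶ / (r² + a² cos²θ)⁶`
(`Kerr.kretschmannScalar_closedForm_holds`, Visser arXiv:0706.0622 §3) we extract the elementary
quantitative consequence used by curvature-wall arguments (idea `horizon-shadowed-bag` of the crux
`LaminatedThreshold`, triage `TRIAGE-r2-1.md` sharpen (3): "`|K| ≥ c/M⁴` on a collar of the Kerr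
horizon, `|a| ≪ M`"): wherever the spin is small against the Kerr–Schild radius, `10 |a| ≤ r`,

  `|Rm|²(g_{M,a})(x) ≥ 32 M² / r⁶`        (`Kerr.kretschmannScalar_ge_of_abs_spin_le`),

so that on the collar `r ≤ 3M` (which contains the horizon sphere `r = r₊ ≤ 2M` and, for
`10|a| ≤ M`, every radius `M ≤ r ≤ 3M`) `|Rm|² ≥ 32 / (729 M⁴)`
(`Kerr.kretschmannScalar_ge_of_radius_le`); the same bound for the Kretschmann scalar
`Spacetime.kretschmannAt` of the Kerr spacetime `Kerr.spacetime M a r₀`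
(`Kerr.kretschmannAt_spacetime_ge`). Proof: `Re (r + i s)⁶ = r⁶ − 15r⁴s² + 15r²s⁴ − s⁶ ≥ 0.84 r⁶` and
`(r² + s²)⁶ ≤ 1.01⁶ r¹²` for `s = a x₃/r`, `|s| ≤ |a| ≤ r/10` (`|x₃| ≤ r`). Paired with
`Spacetime.abs_kretschmannAt_le_of_deviationCk_le` (`FlatChartKretschmannBound.lean`: an `ε`-flat
chart sees only `O(ε²)` Kretschmann curvature) this separates `ε`-flat late charts from the
near-horizon collar of a slowly rotating Kerr region. Everything is proved; no definitions.

## References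

* M. Visser, *The Kerr spacetime: a brief introduction*, arXiv:0706.0622, §3. [arXiv07060622]
* R. C. Henry, Astrophys. J. 535 (2000) 350 (Kretschmann scalar of Kerr–Newman).
-/

noncomputable section

open Set

namespace Literature.Geometry.Lorentzian.Kerr

/-- **Kretschmann lower bound at small spin-to-radius ratio**: for `M, a` real and a point with
Kerr–Schild radius `r > 0` and `10 |a| ≤ r`, `|Rm|²(g_{M,a})(x) ≥ 32 M² / r⁶` (from the closed form:
`Re (r + i s)⁶ ≥ 0.84 r⁶`, `(r² + s²)⁶ ≤ 1.01⁶ r¹²` with `s = a x₃ / r`, `|s| ≤ r/10`).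
[cite: arXiv07060622, §3] -/
theorem kretschmannScalar_ge_of_abs_spin_le (M a : ℝ) {x : E4} (hr : 0 < radius a x)
    (ha : 10 * |a| ≤ radius a x) :
    32 * M ^ 2 / radius a x ^ 6 ≤ MetricCoord.rmNormSqAt (Kerr.bilin M a) x := by
  rw [kretschmannScalar_closedForm_holds M a x hr, Complex.re_add_mul_I_pow_six]
  set r := radius a x with hrdef
  set s := a * (x 3 / r) with hsdef
  have hx3 : |x 3| ≤ r := KerrSchildChart.abs_apply_three_le_radius hr
  have hs : |s| ≤ |a| := by
    rw [hsdef, abs_mul, abs_div, abs_of_pos hr]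
    calc |a| * (|x 3| / r) ≤ |a| * 1 := by
          gcongr
          rwa [div_le_one hr]
      _ = |a| := mul_one _
  have hs10 : 10 * |s| ≤ r := le_trans (by linarith) ha
  have hs2 : s ^ 2 ≤ r ^ 2 / 100 := by
    have h1 : (10 * |s|) ^ 2 ≤ r ^ 2 := pow_le_pow_left₀ (by positivity) hs10 2
    have h2 : (10 * |s|) ^ 2 = 100 * s ^ 2 := by rw [mul_pow, sq_abs]; norm_num
    rw [h2] at h1
    linarith
  have hs4 : s ^ 4 ≤ r ^ 4 / 10000 := by
    have h := pow_le_pow_left₀ (sq_nonneg s) hs2 2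
    have e1 : (s ^ 2) ^ 2 = s ^ 4 := by ring
    have e2 : (r ^ 2 / 100) ^ 2 = r ^ 4 / 10000 := by ring
    rwa [e1, e2] at h
  have hs6 : s ^ 6 ≤ r ^ 6 / 1000000 := by
    have h := pow_le_pow_left₀ (sq_nonneg s) hs2 3
    have e1 : (s ^ 2) ^ 3 = s ^ 6 := by ring
    have e2 : (r ^ 2 / 100) ^ 3 = r ^ 6 / 1000000 := by ring
    rwa [e1, e2] at h
  have hr2 : 0 ≤ r ^ 2 := sq_nonneg r
  have hr4 : 0 ≤ r ^ 4 := by positivity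
  have hs4' : 0 ≤ s ^ 4 := by positivity
  -- numerator and denominator
  have hnum : 84 / 100 * r ^ 6 ≤ r ^ 6 - 15 * r ^ 4 * s ^ 2 + 15 * r ^ 2 * s ^ 4 - s ^ 6 := by
    have h15 : 15 * r ^ 4 * s ^ 2 ≤ 15 * r ^ 4 * (r ^ 2 / 100) := by gcongr
    have hpos : 0 ≤ 15 * r ^ 2 * s ^ 4 := by positivity
    nlinarith
  have hden : (r ^ 2 + s ^ 2) ^ 6 ≤ (101 / 100) ^ 6 * r ^ 12 := by
    have h1 : r ^ 2 + s ^ 2 ≤ 101 / 100 * r ^ 2 := by linarith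
    calc (r ^ 2 + s ^ 2) ^ 6 ≤ (101 / 100 * r ^ 2) ^ 6 := pow_le_pow_left₀ (by positivity) h1 6
      _ = (101 / 100) ^ 6 * r ^ 12 := by ring
  have hden0 : 0 < (r ^ 2 + s ^ 2) ^ 6 := by positivity
  have hr6 : 0 < r ^ 6 := by positivity
  rw [div_le_div_iff₀ hr6 hden0]
  have hM2 : 0 ≤ M ^ 2 := sq_nonneg M
  calc 32 * M ^ 2 * (r ^ 2 + s ^ 2) ^ 6
      ≤ 32 * M ^ 2 * ((101 / 100) ^ 6 * r ^ 12) := by gcongr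
    _ ≤ 48 * M ^ 2 * (84 / 100 * r ^ 6) * r ^ 6 := by nlinarith
    _ ≤ 48 * M ^ 2 * (r ^ 6 - 15 * r ^ 4 * s ^ 2 + 15 * r ^ 2 * s ^ 4 - s ^ 6) * r ^ 6 := by
        gcongr

/-- **Kretschmann lower bound on the horizon collar of slowly rotating Kerr**: for `M > 0`,
`10 |a| ≤ r ≤ 3M` at `x` (Kerr–Schild radius `r`; the collar contains the horizon `r₊ ≤ 2M` once
`10|a| ≤ r₊`), `|Rm|²(g_{M,a})(x) ≥ 32 / (729 M⁴)` — the curvature WALL constant of a slowly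
rotating Kerr end state. [cite: arXiv07060622, §3] -/
theorem kretschmannScalar_ge_of_radius_le {M a : ℝ} (hM : 0 < M) {x : E4} (hr : 0 < radius a x)
    (ha : 10 * |a| ≤ radius a x) (h3 : radius a x ≤ 3 * M) :
    32 / (729 * M ^ 4) ≤ MetricCoord.rmNormSqAt (Kerr.bilin M a) x := by
  refine le_trans ?_ (kretschmannScalar_ge_of_abs_spin_le M a hr ha)
  have hr6 : radius a x ^ 6 ≤ (3 * M) ^ 6 := pow_le_pow_left₀ hr.le h3 6
  have hr6' : 0 < radius a x ^ 6 := by positivity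
  rw [div_le_div_iff₀ (by positivity) hr6']
  calc 32 * radius a x ^ 6 ≤ 32 * (3 * M) ^ 6 := by gcongr
    _ = 32 * M ^ 2 * (729 * M ^ 4) := by ring

/-- The same wall constant for the Kretschmann scalar `Spacetime.kretschmannAt` of the Kerr
SPACETIME `Kerr.spacetime M a r₀` (the scalar read through the preferred chart;
`Kerr.kretschmannAt_spacetime`): at every point with `10 |a| ≤ r ≤ 3M`,
`kretschmannAt ≥ 32 / (729 M⁴)`. [cite: arXiv07060622, §3] -/
theorem kretschmannAt_spacetime_ge [Kerr.Facts] {M : ℝ} (hM : 0 < M) (a r₀ : ℝ)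
    (x : (Kerr.spacetime M a r₀ hM.le).carrier) (ha : 10 * |a| ≤ radius a x.1)
    (h3 : radius a x.1 ≤ 3 * M) :
    32 / (729 * M ^ 4) ≤ (Kerr.spacetime M a r₀ hM.le).kretschmannAt x := by
  have hr : 0 < radius a x.1 := Kerr.radius_pos_of_mem_region x.2
  rw [Kerr.kretschmannAt_spacetime kretschmannScalar_closedForm_holds M a r₀ hM.le x,
    ← kretschmannScalar_closedForm_holds M a x.1 hr]
  exact kretschmannScalar_ge_of_radius_le hM hr ha h3

end Literature.Geometry.Lorentzian.Kerr

end
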